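import Literature.Analysis.FluidPDE.NewtonPotentialHolder
import Mathlib.MeasureTheory.Integral.MeanInequalities
import HarnessLib

/-!
# Route `LerayQuarterDissipation`, item `RecurrentReductionD` (stmt-NavierStokesRegularity-22507):
# far-field Hölder bounds for the Oseen envelope against `L⁶` slices

Helper file (theorems only, `--supports` the item). Second batch of kernel bookkeeping for the
sup-norm ε-regularity of the finite-dissipation stratum `𝒟`: the members of `𝒟` have slices in
`L⁶(ℝ³)` (`exists_eLpNorm_six_slice_le`), and the influence of the far field through the
Koch–Tataru envelope `E_σ(z) = (σ + ‖z‖²)^{−2}` is measured by Hölder's inequality on the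
exterior of a ball, where `E_σ ≤ ‖z‖^{−4}` uniformly in the kernel time `σ`:

* `lintegral_env_mul_le_of_holder` — for Hölder conjugate `p, q` with `4p > 3`,
  `∫_{‖y−x‖≥s} E_σ(x−y) F(y) dy ≤ (3|B₁| s^{3−4p}/(4p−3))^{1/p} (∫_{‖y−x‖≥s} F^q)^{1/q}`;
* `lintegral_env_mul_enorm_le` — `p = 6/5`: `∫_{‖y−x‖≥s} E_σ(x−y)‖f(y)‖ dy ≤ c₃ s^{−3/2} ‖f‖_{L⁶}`;
* `lintegral_env_mul_enorm_sq_le` — `p = 3/2`: `∫_{‖y−x‖≥s} E_σ(x−y)‖f(y)‖² dy ≤ c₄ s^{−2} ‖f‖²_{L⁶}`.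

References: G. Koch, N. Nadirashvili, G. Seregin, V. Šverák, arXiv:0709.3599, §3 (3.8)
[KochNadirashviliSereginSverak2009].
-/

noncomputable section

-- the summit and its single problem share the name (D-0017 nested layout)
set_option linter.dupNamespace false

namespace Summit.NavierStokesRegularity.NavierStokesRegularity.Theorems.RecurrentReductionD

open MeasureTheory Set Function Filter Topology Metric
open Literature.Analysis Literature.Analysis.FluidPDE
open scoped ENNReal NNReal

/-- On the exterior of `B(x, s)`, `s > 0`, the envelope is at most a pure power:
`(σ + ‖x−y‖²)^{−2} ≤ ‖x − y‖^{−4}` for `σ > 0`, hence `((σ + ‖x−y‖²)^{−2})^{p} ≤ ‖x−y‖^{−4p}` for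
`p ≥ 0`. [folklore] -/
theorem env_rpow_le_norm_rpow {σ s : ℝ} (hσ : 0 < σ) (hs : 0 < s) {x y : EuclideanSpace ℝ (Fin 3)}
    (hy : y ∈ (ball x s)ᶜ) {p : ℝ} (hp : 0 ≤ p) :
    ((σ + ‖x - y‖ ^ 2) ^ (-(2 : ℝ))) ^ p ≤ ‖x - y‖ ^ (-(4 * p)) := by
  have hy' : s ≤ ‖x - y‖ := by
    rw [mem_compl_iff, mem_ball, dist_eq_norm, not_lt, norm_sub_rev] at hy; exact hy
  have hxy : 0 < ‖x - y‖ := hs.trans_le hy'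
  have h1 : (σ + ‖x - y‖ ^ 2) ^ (-(2 : ℝ)) ≤ ‖x - y‖ ^ (-(4 : ℝ)) := by
    calc (σ + ‖x - y‖ ^ 2) ^ (-(2 : ℝ)) ≤ (‖x - y‖ ^ 2) ^ (-(2 : ℝ)) :=
          Real.rpow_le_rpow_of_nonpos (by positivity) (by linarith) (by norm_num)
      _ = ‖x - y‖ ^ (-(4 : ℝ)) := by
          rw [← Real.rpow_natCast, ← Real.rpow_mul hxy.le]; norm_num
  calc ((σ + ‖x - y‖ ^ 2) ^ (-(2 : ℝ))) ^ p ≤ (‖x - y‖ ^ (-(4 : ℝ))) ^ p :=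
        Real.rpow_le_rpow (Real.rpow_nonneg (by positivity) _) h1 hp
    _ = ‖x - y‖ ^ (-(4 * p)) := by rw [← Real.rpow_mul hxy.le]; ring_nf

/-- **Hölder on the exterior of a ball against the envelope.** For Hölder conjugate reals
`p, q` with `4p > 3`, `σ, s > 0` and an a.e.-measurable `F ≥ 0`,
`∫⁻_{‖y−x‖≥s} (σ+‖x−y‖²)^{−2} F(y) dy ≤ (3|B₁| s^{3−4p}/(4p−3))^{1/p} (∫⁻_{‖y−x‖≥s} F^q)^{1/q}`
(`ENNReal.lintegral_mul_le_Lp_mul_Lq` and `∫_{‖z‖≥s}‖z‖^{−4p} = 3|B₁|s^{3−4p}/(4p−3)`). [folklore] -/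
theorem lintegral_env_mul_le_of_holder {p q : ℝ} (hpq : p.HolderConjugate q) (hp3 : 3 < 4 * p)
    {σ s : ℝ} (hσ : 0 < σ) (hs : 0 < s) (x : EuclideanSpace ℝ (Fin 3))
    {F : EuclideanSpace ℝ (Fin 3) → ℝ≥0∞}
    (hF : AEMeasurable F (volume.restrict (ball x s)ᶜ)) :
    ∫⁻ y in (ball x s)ᶜ, ENNReal.ofReal ((σ + ‖x - y‖ ^ 2) ^ (-(2 : ℝ))) * F y ≤
      ENNReal.ofReal ((3 * (volume : Measure (EuclideanSpace ℝ (Fin 3))).real (ball 0 1) *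
          (s ^ (3 - 4 * p) / (4 * p - 3))) ^ (1 / p)) *
        (∫⁻ y in (ball x s)ᶜ, F y ^ q) ^ (1 / q) := by
  have hp0 : 0 < p := hpq.pos
  have hp0' : 0 ≤ p := hp0.le
  set μ : Measure (EuclideanSpace ℝ (Fin 3)) := volume.restrict (ball x s)ᶜ with hμ
  have hE : AEMeasurable (fun y : EuclideanSpace ℝ (Fin 3) =>
      ENNReal.ofReal ((σ + ‖x - y‖ ^ 2) ^ (-(2 : ℝ)))) μ := by
    refine (Measurable.ennreal_ofReal ?_).aemeasurable
    have hne : ∀ y : EuclideanSpace ℝ (Fin 3), σ + ‖x - y‖ ^ 2 ≠ 0 := fun y => by positivity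
    have hc : Continuous fun y : EuclideanSpace ℝ (Fin 3) => σ + ‖x - y‖ ^ 2 := by fun_prop
    exact (hc.rpow_const fun y => Or.inl (hne y)).measurable
  have hH := ENNReal.lintegral_mul_le_Lp_mul_Lq μ hpq hE hF
  simp only [Pi.mul_apply] at hH
  refine hH.trans ?_
  gcongr
  -- the envelope factor
  have hVt : 0 ≤ 3 * (volume : Measure (EuclideanSpace ℝ (Fin 3))).real (ball 0 1) *
      (s ^ (3 - 4 * p) / (4 * p - 3)) := by
    have : 0 < 4 * p - 3 := by linarith
    positivity
  calc (∫⁻ y, ENNReal.ofReal ((σ + ‖x - y‖ ^ 2) ^ (-(2 : ℝ))) ^ p ∂μ) ^ (1 / p)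
      ≤ (∫⁻ y in (ball x s)ᶜ, ENNReal.ofReal (‖x - y‖ ^ (-(4 * p)))) ^ (1 / p) := by
        gcongr ?_ ^ _
        refine setLIntegral_mono' measurableSet_ball.compl fun y hy => ?_
        rw [ENNReal.ofReal_rpow_of_nonneg (Real.rpow_nonneg (by positivity) _) hp0']
        exact ENNReal.ofReal_le_ofReal (env_rpow_le_norm_rpow hσ hs hy hp0')
    _ = (ENNReal.ofReal (3 * (volume : Measure (EuclideanSpace ℝ (Fin 3))).real (ball 0 1) *
          (s ^ (3 - 4 * p) / (4 * p - 3)))) ^ (1 / p) := by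
        rw [NewtonPotentialHolder.lintegral_compl_ball_comp_sub_left
          (fun z => ENNReal.ofReal (‖z‖ ^ (-(4 * p)))) x s,
          NewtonPotentialHolder.lintegral_compl_ball_norm_rpow_neg (by linarith) hs]
    _ = ENNReal.ofReal ((3 * (volume : Measure (EuclideanSpace ℝ (Fin 3))).real (ball 0 1) *
          (s ^ (3 - 4 * p) / (4 * p - 3))) ^ (1 / p)) :=
        ENNReal.ofReal_rpow_of_nonneg hVt (by positivity)

/-- **Far-field bound, first order**: `∫⁻_{‖y−x‖≥s} (σ+‖x−y‖²)^{−2} ‖f(y)‖ dy ≤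
c₃ s^{−3/2} ‖f‖_{L⁶}`, `c₃ = (3|B₁|·(5/9))^{5/6}` (`p = 6/5`, `q = 6`). [folklore] -/
theorem lintegral_env_mul_enorm_le {σ s : ℝ} (hσ : 0 < σ) (hs : 0 < s)
    (x : EuclideanSpace ℝ (Fin 3)) {f : EuclideanSpace ℝ (Fin 3) → EuclideanSpace ℝ (Fin 3)}
    (hf : AEStronglyMeasurable f volume) :
    ∫⁻ y in (ball x s)ᶜ, ENNReal.ofReal ((σ + ‖x - y‖ ^ 2) ^ (-(2 : ℝ))) * ‖f y‖ₑ ≤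
      ENNReal.ofReal ((3 * (volume : Measure (EuclideanSpace ℝ (Fin 3))).real (ball 0 1) *
          (5 / 9)) ^ (5 / 6 : ℝ) * s ^ (-(3 / 2 : ℝ))) * eLpNorm f 6 volume := by
  have hpq : (6 / 5 : ℝ).HolderConjugate 6 := by
    rw [Real.holderConjugate_iff]; norm_num
  have hF : AEMeasurable (fun y => ‖f y‖ₑ) (volume.restrict (ball x s)ᶜ) :=
    hf.restrict.enorm
  have h := lintegral_env_mul_le_of_holder hpq (by norm_num) hσ hs x hF
  refine h.trans ?_
  have hV0 : 0 ≤ 3 * (volume : Measure (EuclideanSpace ℝ (Fin 3))).real (ball 0 1) := by positivity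
  -- the `L⁶` factor
  have h6 : (∫⁻ y in (ball x s)ᶜ, ‖f y‖ₑ ^ (6 : ℝ)) ^ (1 / (6 : ℝ)) ≤ eLpNorm f 6 volume := by
    rw [eLpNorm_eq_lintegral_rpow_enorm_toReal (by norm_num) (by norm_num),
      show (6 : ℝ≥0∞).toReal = 6 by norm_num]
    gcongr ?_ ^ _
    exact lintegral_mono' Measure.restrict_le_self le_rfl
  -- the constant
  have hconst : ENNReal.ofReal ((3 * (volume : Measure (EuclideanSpace ℝ (Fin 3))).real (ball 0 1) *
        (s ^ (3 - 4 * (6 / 5 : ℝ)) / (4 * (6 / 5 : ℝ) - 3))) ^ (1 / (6 / 5 : ℝ))) =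
      ENNReal.ofReal ((3 * (volume : Measure (EuclideanSpace ℝ (Fin 3))).real (ball 0 1) *
          (5 / 9)) ^ (5 / 6 : ℝ) * s ^ (-(3 / 2 : ℝ))) := by
    congr 1
    rw [show (3 : ℝ) - 4 * (6 / 5) = -(9 / 5) by norm_num, show (4 : ℝ) * (6 / 5) - 3 = 9 / 5 by norm_num,
      show (1 : ℝ) / (6 / 5) = 5 / 6 by norm_num, div_eq_mul_inv, ← mul_assoc,
      show (9 / 5 : ℝ)⁻¹ = 5 / 9 by norm_num,
      show 3 * (volume : Measure (EuclideanSpace ℝ (Fin 3))).real (ball 0 1) * s ^ (-(9 / 5 : ℝ)) *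
        (5 / 9 : ℝ) = (3 * (volume : Measure (EuclideanSpace ℝ (Fin 3))).real (ball 0 1) * (5 / 9)) *
        s ^ (-(9 / 5 : ℝ)) by ring,
      Real.mul_rpow (by positivity) (Real.rpow_nonneg hs.le _), ← Real.rpow_mul hs.le]
    norm_num
  rw [hconst]
  gcongr

/-- **Far-field bound, second order**: `∫⁻_{‖y−x‖≥s} (σ+‖x−y‖²)^{−2} ‖f(y)‖² dy ≤
c₄ s^{−2} ‖f‖²_{L⁶}`, `c₄ = |B₁|^{2/3}` (`p = 3/2`, `q = 3`). [folklore] -/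
theorem lintegral_env_mul_enorm_sq_le {σ s : ℝ} (hσ : 0 < σ) (hs : 0 < s)
    (x : EuclideanSpace ℝ (Fin 3)) {f : EuclideanSpace ℝ (Fin 3) → EuclideanSpace ℝ (Fin 3)}
    (hf : AEStronglyMeasurable f volume) :
    ∫⁻ y in (ball x s)ᶜ, ENNReal.ofReal ((σ + ‖x - y‖ ^ 2) ^ (-(2 : ℝ))) * ‖f y‖ₑ ^ 2 ≤
      ENNReal.ofReal ((3 * (volume : Measure (EuclideanSpace ℝ (Fin 3))).real (ball 0 1) *
          (1 / 3)) ^ (2 / 3 : ℝ) * s ^ (-(2 : ℝ))) * eLpNorm f 6 volume ^ 2 := by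
  have hpq : (3 / 2 : ℝ).HolderConjugate 3 := by
    rw [Real.holderConjugate_iff]; norm_num
  have hF : AEMeasurable (fun y => ‖f y‖ₑ ^ 2) (volume.restrict (ball x s)ᶜ) :=
    hf.restrict.enorm.pow_const 2
  have h := lintegral_env_mul_le_of_holder hpq (by norm_num) hσ hs x hF
  refine h.trans ?_
  -- the `L⁶` factor: `(∫ (‖f‖²)³)^{1/3} = ((∫ ‖f‖⁶)^{1/6})²`
  have h6 : (∫⁻ y in (ball x s)ᶜ, (‖f y‖ₑ ^ 2) ^ (3 : ℝ)) ^ (1 / (3 : ℝ)) ≤ eLpNorm f 6 volume ^ 2 := by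
    rw [eLpNorm_eq_lintegral_rpow_enorm_toReal (by norm_num) (by norm_num),
      show (6 : ℝ≥0∞).toReal = 6 by norm_num]
    have e1 : ∀ y, (‖f y‖ₑ ^ 2) ^ (3 : ℝ) = ‖f y‖ₑ ^ (6 : ℝ) := fun y => by
      rw [← ENNReal.rpow_natCast, ← ENNReal.rpow_mul]; norm_num
    simp_rw [e1]
    have e2 : ((∫⁻ y, ‖f y‖ₑ ^ (6 : ℝ)) ^ (1 / (6 : ℝ))) ^ 2 =
        (∫⁻ y, ‖f y‖ₑ ^ (6 : ℝ)) ^ (1 / (3 : ℝ)) := by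
      rw [← ENNReal.rpow_natCast, ← ENNReal.rpow_mul]; norm_num
    rw [e2]
    gcongr ?_ ^ _
    exact lintegral_mono' Measure.restrict_le_self le_rfl
  have hconst : ENNReal.ofReal ((3 * (volume : Measure (EuclideanSpace ℝ (Fin 3))).real (ball 0 1) *
        (s ^ (3 - 4 * (3 / 2 : ℝ)) / (4 * (3 / 2 : ℝ) - 3))) ^ (1 / (3 / 2 : ℝ))) =
      ENNReal.ofReal ((3 * (volume : Measure (EuclideanSpace ℝ (Fin 3))).real (ball 0 1) *
          (1 / 3)) ^ (2 / 3 : ℝ) * s ^ (-(2 : ℝ))) := by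
    congr 1
    rw [show (3 : ℝ) - 4 * (3 / 2) = -(3 : ℝ) by norm_num, show (4 : ℝ) * (3 / 2) - 3 = 3 by norm_num,
      show (1 : ℝ) / (3 / 2) = 2 / 3 by norm_num, div_eq_mul_inv, ← mul_assoc,
      show (3 : ℝ)⁻¹ = 1 / 3 by norm_num,
      show 3 * (volume : Measure (EuclideanSpace ℝ (Fin 3))).real (ball 0 1) * s ^ (-(3 : ℝ)) *
        (1 / 3 : ℝ) = (3 * (volume : Measure (EuclideanSpace ℝ (Fin 3))).real (ball 0 1) * (1 / 3)) *
        s ^ (-(3 : ℝ)) by ring,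
      Real.mul_rpow (by positivity) (Real.rpow_nonneg hs.le _), ← Real.rpow_mul hs.le]
    norm_num
  rw [hconst]
  gcongr

end Summit.NavierStokesRegularity.NavierStokesRegularity.Theorems.RecurrentReductionD

end
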